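import Literature.RepresentationTheory.TwistedCoinvariantsTensorQuotient
import HarnessLib

/-!
# Coinvariants of a diagonal tensor product, II: the first factor's action on `Coinv (ρ₁ ⊗ ρ₂) χ` and the
# semilinear universal property of the see-saw quotient `q_ψ`

Topic `RepresentationTheory`; namespace `Literature.RepresentationTheory.TwistedCoinv` (continuation of
`TwistedCoinvariantsTensorQuotient.lean`, whose `coinvTprodQuot ρ₁ ρ₂ χ ψ : Coinv (ρ₁.tprod ρ₂) χ →ₗ[k]
Coinv ρ₁ ψ ⊗[k] Coinv ρ₂ (χ * ψ⁻¹)` — the see-saw quotient `q_ψ` — and its kernel description `ker_coinvTprodQuot`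
this file consumes).  KERNEL ONLY: one `def` with body (`repFst`) and proved theorems; no named fact, no instance,
no `sorry`.

For a commutative ring `k`, a COMMUTATIVE group `H`, `H`-representations `ρ₁` on `S₁` and `ρ₂` on `S₂`, and
characters `χ ψ : H →* kˣ`:
* `commute_tprod_one_tprod` — `ρ₁ h ⊗ 1` commutes with the diagonal `ρ₁ h' ⊗ ρ₂ h'` (`H` commutative);
* **`repFst ρ₁ ρ₂ χ : Representation k H (Coinv (ρ₁.tprod ρ₂) χ)`** — the FIRST factor's `H`-action on the
  `χ`-coinvariants, `h ↦` the operator induced by `ρ₁ h ⊗ 1` (tree `TwistedCoinv.rep`); `repFst_mk`,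
  `repFst_mk_tmul` (`repFst h (mk (v ⊗ e)) = mk (ρ₁ h v ⊗ e)`);
* `coinvTprodQuot_repFst` — `q_ψ` intertwines `repFst` with the character `ψ`: `q_ψ (repFst h x) = ψ h • q_ψ x`;
* `ker_coinvTprodQuot_le_ker` — the kernel of `q_ψ` is killed by every `σ`-SEMILINEAR map `f` out of
  `Coinv (ρ₁ ⊗ ρ₂) χ` on which `repFst` acts through `σ ∘ ψ`;
* **`coinvTprodQuot_liftₛₗ`** — hence such an `f` FACTORS UNIQUELY through `q_ψ`
  (`∃! f', f = f'.comp (coinvTprodQuot ρ₁ ρ₂ χ ψ)`; `Submodule.liftQ` + the first isomorphism theorem for the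
  surjection `q_ψ`).  The linear case `σ = id` is `coinvTprodQuot_universal` of the first file; the semilinear form
  is the one met by `ι`-semilinear Hecke-equivariant maps into `ℚ_ℓ^{ac} ⊗ H¹_ét`.

This is the see-saw bookkeeping of [Liu2021, proof of Thm. 4.15, l. 2199–2212] (the `χ`-coinvariants of a tensor
product of Weil representations under the diagonal unitary group of a line, whose centre acts through the first
factor; cf. [GelbartRogawski1991, §3.1]) in the abstract coinvariant currency of [Liu2021, App. D §D.1 Step 3].

## References
* [Liu2021] Y. Liu, *Fourier–Jacobi cycles and arithmetic relative trace formula*, Camb. J. Math. 9 (2021): proof of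
  Thm. 4.15 (l. 2199–2212), App. D §D.1 Step 3 (l. 5221).
* [GelbartRogawski1991] S. Gelbart, J. Rogawski, *L-functions and Fourier–Jacobi coefficients for the unitary group
  U(3)*, Invent. Math. 105 (1991), §3.1 (see-saw duality), pp. 454–457.
-/

set_option autoImplicit false

noncomputable section

namespace Literature.RepresentationTheory.TwistedCoinv

open scoped TensorProduct

variable {k : Type*} [CommRing k] {H S₁ S₂ : Type*} [CommGroup H]
  [AddCommGroup S₁] [Module k S₁] [AddCommGroup S₂] [Module k S₂]
  (ρ₁ : Representation k H S₁) (ρ₂ : Representation k H S₂) (χ ψ : H →* kˣ)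

/-- for a COMMUTATIVE `H`, `ρ₁ h ⊗ 1` commutes with the diagonal `ρ₁ h' ⊗ ρ₂ h'`. [cite: GelbartRogawski1991, §3.1 p. 454] -/
theorem commute_tprod_one_tprod (h h' : H) :
    Commute ((ρ₁.tprod (1 : Representation k H S₂)) h) ((ρ₁.tprod ρ₂) h') :=
  commute_tprod_one ρ₁ ρ₂ ρ₁ (fun a b => show ρ₁ a * ρ₁ b = ρ₁ b * ρ₁ a by rw [← map_mul, mul_comm, map_mul]) h h'

/-- **The FIRST factor's `H`-action on `Coinv (ρ₁ ⊗ ρ₂) χ`** (`h ↦` the operator induced by `ρ₁ h ⊗ 1`; well defined because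
`H` is commutative).  In the see-saw of [Liu2021, Thm. 4.15] this is how the CENTRE of the unitary group of the plane acts on the
`χ`-coinvariants of `ω ⊗ ω` (the two centres of the rank-`(2,1)` pair act identically on the Weil module, tree
`UnitaryDualPair.WeilCoinv.finPairRepV_finAdelicCenter`). [cite: Liu2021, proof of Thm. 4.15 (FJcycle.tex l. 2199–2212); App. D §D.1 Step 3 (l. 5221)] -/
def repFst : Representation k H (Coinv (ρ₁.tprod ρ₂) χ) :=
  rep χ (ρ₁.tprod (1 : Representation k H S₂)) (commute_tprod_one_tprod ρ₁ ρ₂)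

/-- `repFst h (mk t) = mk ((ρ₁ h ⊗ 1) t)`. [cite: Liu2021, App. D §D.1 Step 3 (l. 5221)] -/
theorem repFst_mk (h : H) (t : S₁ ⊗[k] S₂) :
    repFst ρ₁ ρ₂ χ h (mk (ρ₁.tprod ρ₂) χ t) = mk (ρ₁.tprod ρ₂) χ (TensorProduct.map (ρ₁ h) LinearMap.id t) := by
  rw [repFst, rep_mk, Representation.tprod_apply]
  rfl

/-- `repFst h (mk (v ⊗ e)) = mk (ρ₁ h v ⊗ e)`. [cite: Liu2021, App. D §D.1 Step 3 (l. 5221)] -/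
theorem repFst_mk_tmul (h : H) (v : S₁) (e : S₂) :
    repFst ρ₁ ρ₂ χ h (mk (ρ₁.tprod ρ₂) χ (v ⊗ₜ[k] e)) = mk (ρ₁.tprod ρ₂) χ (ρ₁ h v ⊗ₜ[k] e) := by
  rw [repFst_mk, TensorProduct.map_tmul, LinearMap.id_apply]

/-- `q_ψ` intertwines `repFst` with the character `ψ`: `q_ψ (repFst h x) = ψ h • q_ψ x`. [cite: Liu2021, App. D §D.1 Step 3 (l. 5221)] -/
theorem coinvTprodQuot_repFst (h : H) (x : Coinv (ρ₁.tprod ρ₂) χ) :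
    coinvTprodQuot ρ₁ ρ₂ χ ψ (repFst ρ₁ ρ₂ χ h x) = ((ψ h : kˣ) : k) • coinvTprodQuot ρ₁ ρ₂ χ ψ x := by
  obtain ⟨t, rfl⟩ := mk_surjective (ρ₁.tprod ρ₂) χ x
  induction t using TensorProduct.induction_on with
  | zero => simp only [map_zero, smul_zero]
  | tmul v e =>
    rw [repFst_mk_tmul, coinvTprodQuot_mk_tmul, coinvTprodQuot_mk_tmul, mk_ρW, TensorProduct.smul_tmul']
  | add x y hx hy => simp only [map_add, hx, hy, smul_add]

/-- **The kernel of `q_ψ` is killed by every SEMILINEAR map on which `repFst` acts through `ψ`** (`ker_coinvTprodQuot`: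
`ker q_ψ = mk (R_ψ(ρ₁ ⊗ 1))`). [cite: Liu2021, proof of Thm. 4.15 (FJcycle.tex l. 2199–2212)] -/
theorem ker_coinvTprodQuot_le_ker {k₂ : Type*} [CommRing k₂] {σ : k →+* k₂} {M : Type*} [AddCommGroup M] [Module k₂ M]
    (f : Coinv (ρ₁.tprod ρ₂) χ →ₛₗ[σ] M) (hf : ∀ (h : H) (x : Coinv (ρ₁.tprod ρ₂) χ), f (repFst ρ₁ ρ₂ χ h x) = σ (ψ h) • f x) :
    LinearMap.ker (coinvTprodQuot ρ₁ ρ₂ χ ψ) ≤ LinearMap.ker f := by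
  rw [ker_coinvTprodQuot, Submodule.map_le_iff_le_comap, ker, Submodule.span_le]
  rintro _ ⟨⟨h, t⟩, rfl⟩
  rw [SetLike.mem_coe, Submodule.mem_comap, LinearMap.mem_ker, map_sub, map_smul, map_sub, LinearMap.map_smulₛₗ]
  change f (mk (ρ₁.tprod ρ₂) χ ((ρ₁.tprod (1 : Representation k H S₂)) h t)) - σ ((ψ h : kˣ) : k) • f (mk (ρ₁.tprod ρ₂) χ t) = 0
  have e : (ρ₁.tprod (1 : Representation k H S₂)) h t = TensorProduct.map (ρ₁ h) LinearMap.id t := by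
    rw [Representation.tprod_apply]; rfl
  rw [e, ← repFst_mk, hf, sub_self]

/-- **SEMILINEAR universal property of `q_ψ`**: a `σ`-semilinear map `f` out of `Coinv (ρ₁ ⊗ ρ₂) χ` on which the first factor's
`H`-action `repFst` acts through `σ ∘ ψ` FACTORS uniquely through `q_ψ` (the elements of `omegaHom` are `ι`-semilinear, hence this form;
`σ = id` is `coinvTprodQuot_universal`).  Proof: `ker q_ψ ≤ ker f` (`ker_coinvTprodQuot_le_ker`), `Submodule.liftQ`, and the
first isomorphism theorem for the surjection `q_ψ`. [cite: Liu2021, proof of Thm. 4.15 (FJcycle.tex l. 2199–2212); App. D §D.1 Step 3 (l. 5221)] -/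
theorem coinvTprodQuot_liftₛₗ {k₂ : Type*} [CommRing k₂] {σ : k →+* k₂} {M : Type*} [AddCommGroup M] [Module k₂ M]
    (f : Coinv (ρ₁.tprod ρ₂) χ →ₛₗ[σ] M) (hf : ∀ (h : H) (x : Coinv (ρ₁.tprod ρ₂) χ), f (repFst ρ₁ ρ₂ χ h x) = σ (ψ h) • f x) :
    ∃! f' : Coinv ρ₁ ψ ⊗[k] Coinv ρ₂ (χ * ψ⁻¹) →ₛₗ[σ] M, f = f'.comp (coinvTprodQuot ρ₁ ρ₂ χ ψ) := by
  set q := coinvTprodQuot ρ₁ ρ₂ χ ψ with hq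
  have hqs : Function.Surjective q := coinvTprodQuot_surjective ρ₁ ρ₂ χ ψ
  refine ⟨((LinearMap.ker q).liftQ f (ker_coinvTprodQuot_le_ker ρ₁ ρ₂ χ ψ f hf)).comp
      (q.quotKerEquivOfSurjective hqs).symm.toLinearMap, ?_, ?_⟩
  · refine LinearMap.ext fun x => ?_
    rw [LinearMap.comp_apply, LinearMap.comp_apply, LinearEquiv.coe_toLinearMap, LinearMap.quotKerEquivOfSurjective_symm_apply,
      Submodule.liftQ_apply]
  · intro f'' hf''
    refine LinearMap.ext fun y => ?_
    obtain ⟨x, rfl⟩ := hqs y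
    rw [LinearMap.comp_apply, LinearEquiv.coe_toLinearMap, LinearMap.quotKerEquivOfSurjective_symm_apply, Submodule.liftQ_apply,
      hf'', LinearMap.comp_apply]

end Literature.RepresentationTheory.TwistedCoinv

end
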